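import Summits.Ventures.DiscreteObjects.Hadamard.PaleyLP167
import Literature.Combinatorics.Designs.PropusArray

/-!
# Row F8, symmetric form: a D-optimal pair of length 167 with one SYMMETRIC block gives a SYMMETRIC Hadamard matrix of
# order 668 (Balonin–Seberry propus family, kernel)

Framing: lottery ticket; floor = certified bounds/negative ranges.  Cell pub-namedobj (venture DiscreteObjects),
target (H), hadamard gen 27.  PRINT STATUS: the construction is Seberry–Balonin's (Seberry–Yamada 2020 §9.10.1 (iii):
"`t ≡ 3 (mod 4)` a prime such that D-optimal designs, constructed using two circulant matrices of order `t`, one of which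
must be circulant and symmetric, [exist ⇒] the propus-type symmetric Hadamard matrices of order `4t` exist"; Balonin–Seberry
list `t = 167` among the unresolved propus orders).  With the tree's propus array (`Literature.…PropusArray`,
Balonin–Đoković–Karbovskiy 2018) and gen 2's Paley block `paley167 = χ′` (`PAF = −1`), the kernel statement is:
* **`symmHadamard668_of_symmDOptPair167`** — if `c, d : ZMod 167 → ℤ` are `±1` with `PAF_c(s) + PAF_d(s) = 2 (s ≠ 0)`
  (a D-optimal pair, TABLE-H row F8 / gen 27 `DOptimalRoute668`) and `c` is symmetric (`c (−x) = c x`), then the propus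
  matrix `P(c, χ′, χ′, d)` is a SYMMETRIC Hadamard matrix of order `668` — so such a pair would settle TWO open named
  objects at once (`H(668)` and a symmetric `H(668)`); `propusHadamard668_of_dOptPair167` is the unsymmetric version
  (any D-optimal pair; complements `hadamard668_of_dOptPair167`, which used the Goethals–Seidel array).
* `(+)` CONTROL **`symmHadamard28_of_symmDOptPair7`**: at `v = 7`, `c = J − 2δ₀` (symmetric, `PAF = 3`) and `d = χ₇′`
  (`PAF = −1`) form a D-optimal pair and `P(c, χ₇′, χ₇′, d)` is a symmetric `H(28)` (conditions by kernel evaluation).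
Census reading: gen 27's `dOptPair167_no_pairSymmetry` shows no multiplier symmetry with `h² ≠ 1`; `h = −1` on one block
(the hypothesis here) is OPEN — this file records what it would give.  WORDS: plug-in about hypothetical objects; no order
excluded; `H(668)` untouched.  Ours (formalisation); no `sorry`.
-/

namespace Summit.Ventures.DiscreteObjects.Hadamard

open Finset BigOperators Matrix

open Literature.Combinatorics.Designs.GoethalsSeidel (IsHadamardMatrix)
open Literature.Combinatorics.Designs.LegendrePairs (PAF IsPM)
open Literature.Combinatorics.Designs.Propus (propusMatrix propus_isHadamard propusMatrix_transpose_of_symm)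

/-- **Propus plug-in for row F8 (any D-optimal pair):** `P(c, χ′, χ′, d)` is a Hadamard matrix of order `668`. -/
theorem propusHadamard668_of_dOptPair167 (c d : ZMod 167 → ℤ) (hc : IsPM c) (hd : IsPM d)
    (hcd : ∀ s : ZMod 167, s ≠ 0 → PAF c s + PAF d s = 2) :
    IsHadamardMatrix (propusMatrix c paley167 paley167 d) ∧ Fintype.card (Fin 4 × ZMod 167) = 668 := by
  refine ⟨propus_isHadamard c paley167 paley167 d hc isPM_paley167 isPM_paley167 hd (fun s hs => ?_), by simp [ZMod.card]⟩
  have h1 := paley167_paf s hs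
  have h2 := hcd s hs
  linarith

/-- **Balonin–Seberry at `t = 167` (kernel): a D-optimal pair of length `167` whose block `c` is symmetric gives a SYMMETRIC
Hadamard matrix of order `668`** (the propus matrix `P(c, χ′, χ′, d)`). -/
theorem symmHadamard668_of_symmDOptPair167 (c d : ZMod 167 → ℤ) (hc : IsPM c) (hd : IsPM d)
    (hcd : ∀ s : ZMod 167, s ≠ 0 → PAF c s + PAF d s = 2) (hsym : ∀ x, c (-x) = c x) :
    IsHadamardMatrix (propusMatrix c paley167 paley167 d) ∧
      (propusMatrix c paley167 paley167 d)ᵀ = propusMatrix c paley167 paley167 d ∧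
      Fintype.card (Fin 4 × ZMod 167) = 668 :=
  ⟨(propusHadamard668_of_dOptPair167 c d hc hd hcd).1, propusMatrix_transpose_of_symm c paley167 d hsym,
    by simp [ZMod.card]⟩

/-- **(+) control at `v = 7`**: `c = J − 2δ₀` (symmetric), `d = χ₇′`: a D-optimal pair of length `7` with a symmetric block,
and `P(c, χ₇′, χ₇′, d)` is a symmetric Hadamard matrix of order `28`. -/
theorem symmHadamard28_of_symmDOptPair7 :
    ∃ c q : ZMod 7 → ℤ, IsPM c ∧ IsPM q ∧ (∀ s : ZMod 7, s ≠ 0 → PAF c s + PAF q s = 2) ∧ (∀ x, c (-x) = c x) ∧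
      (∀ s : ZMod 7, s ≠ 0 → PAF q s = -1) ∧ IsHadamardMatrix (propusMatrix c q q q) ∧
      (propusMatrix c q q q)ᵀ = propusMatrix c q q q ∧ Fintype.card (Fin 4 × ZMod 7) = 28 := by
  have hc : IsPM (fun i : ZMod 7 => if i = 0 then (-1 : ℤ) else 1) := by unfold IsPM; decide
  have hq : IsPM (fun i : ZMod 7 => if i = 3 ∨ i = 5 ∨ i = 6 then (-1 : ℤ) else 1) := by unfold IsPM; decide
  have hsym : ∀ x : ZMod 7, (fun i : ZMod 7 => if i = 0 then (-1 : ℤ) else 1) (-x) =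
      (fun i : ZMod 7 => if i = 0 then (-1 : ℤ) else 1) x := by decide
  refine ⟨fun i => if i = 0 then -1 else 1, fun i => if i = 3 ∨ i = 5 ∨ i = 6 then -1 else 1, hc, hq, by decide, hsym,
    by decide, propus_isHadamard _ _ _ _ hc hq hq hq (by decide), propusMatrix_transpose_of_symm _ _ _ hsym,
    by simp [ZMod.card]⟩

end Summit.Ventures.DiscreteObjects.Hadamard
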